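import Mathlib
import HarnessLib
import Summits.NavierStokesRegularity.NavierStokesRegularity.Theorems.UnthreadedDoorKinematicShadowZonalFrame
import Summits.NavierStokesRegularity.NavierStokesRegularity.Theorems.UnthreadedDoorKinematicShadowZonalPoles
import Summits.NavierStokesRegularity.NavierStokesRegularity.Theorems.UnthreadedDoorKinematicShadowZonalAzimuth

/-!
# Route `UnthreadedDoor`, crux `PoloidalLiouville` (stmt-NavierStokesRegularity-1222), WALL W1 — crux idea «kinematic-shadow»
# (ns-idea-15, `Cruxes/PoloidalLiouville/KinematicShadowSketch.lean` v1.2): zonal sub-rung A_z, Stage 2c — THE MERIDIAN IDENTITY (†)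

ARM A (ns-exp-scalarLiouville g5), KEY-NS 02:19Z (2); items R4–R6 of ns-qj-p1's BLUEPRINT-kinematic-shadow-Az (NOTE
kinematic-shadow-zonal-pointwise, steps 4–6).  Data: the zonal potential `Z = t ∘ c` (`t ∈ C³`), a `C¹` divergence-free field `u`,
the head density `f = ⟪u, ∇Z⟫ − ΔZ` and the momentum `m = ⟪u, · − x₀⟫`; the three components of the steady law (from
`KinematicShadow.zonalLaw_components`) are taken as hypotheses on the shell `{R < ‖x − x₀‖}`:
(i) `⟪∇m, e × (x − x₀)⟫ = 0`, (ii) `⟪∇f, e × (x − x₀)⟫ = 0`, (iii) `‖y‖³⟪∇f, ∇c⟫ = −t′(c)((1 − c²)/‖y‖)⟪∇m, y⟫`.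
In the meridian chart `X(r,θ) = x₀ + r e_r(θ)` of an orthonormal pair `e ⊥ n` (`u_r = ⟪u∘X, e_r⟫`, `u_θ = ⟪u∘X, e_θ⟫`,
`h(θ) = t′(cos θ)`, `L(θ) = ΔZ(x₀ + e_r(θ))`):
* `zonalHead_chart` — `f(X) = −(h sin θ / r) u_θ − L(θ)/r²`; `zonal_radial_invariance`, `zonal_polar_invariance` — by (i), (ii)
  and `comp_chart_azimuth_eq`, `u_r`, `u_θ` do not depend on the azimuth (the hypotheses of `azimuthal_strain_eq`);
* `law_iii_chart` — (iii) reads `r ∂_θ(f∘X) = h sin θ ∂_r(m∘X)`;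
* ★ `zonal_dagger` — **(†) `L′(θ) = r sin θ (h(θ) u_r − h′(θ) u_θ)`** on `(R,∞) × (0,π)` (from (iii), `div u = 0` in the frame and
  `∂_φ u_φ = 0`; pure first-order calculus, `dagger_algebra`).

HONEST LABEL: an identity inside an information-grade no-go in the LINEAR kinematic shadow (critic V20); 1222 / W1 / NS regularity OPEN;
nothing here is an NS statement.  `--supports stmt-NavierStokesRegularity-1222 --as helper`.
-/

noncomputable section

-- the summit and its single sub-problem share the name (CONVENTIONS §1)
set_option linter.dupNamespace false

open Set Function Filter Topology InnerProductSpace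
open scoped RealInnerProductSpace Laplacian

namespace Summit.NavierStokesRegularity.NavierStokesRegularity.Theorems.PoloidalLiouville.KinematicShadow

open Literature.Analysis Literature.Analysis.FluidPDE
open Summit.NavierStokesRegularity.NavierStokesRegularity.Theorems.PoloidalLiouville.NetFlux (E3)

variable {x₀ e n : E3} {u : E3 → E3} {t : ℝ → ℝ} {f m : E3 → ℝ} {R : ℝ}

/-! ### Values of the momentum and of the head density on the chart -/

/-- `∇Z = t′(c) ∇c` off the centre. [folklore] -/
theorem gradient_zonal_eq_smul (t : ℝ → ℝ) {x : E3} (hx : x ≠ x₀)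
    (ht : DifferentiableAt ℝ t (⟪x - x₀, e⟫ / ‖x - x₀‖)) :
    gradient (fun w : E3 => t (⟪w - x₀, e⟫ / ‖w - x₀‖)) x =
      deriv t (⟪x - x₀, e⟫ / ‖x - x₀‖) • gradient (fun w : E3 => ⟪w - x₀, e⟫ / ‖w - x₀‖) x := by
  rw [(hasGradientAt_zonal t x₀ e hx ht.hasDerivAt).gradient, (hasGradientAt_axisCos x₀ e hx).gradient]

/-- The momentum on a radial line: `m(x₀ + ρ v) = ρ ⟪u(x₀ + ρ v), v⟫`. [folklore] -/
theorem zonalMomentum_chart (hm : m = fun z : E3 => ⟪u z, z - x₀⟫) (v : E3) (ρ : ℝ) :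
    m (x₀ + ρ • v) = ρ * ⟪u (x₀ + ρ • v), v⟫ := by
  rw [hm]; simp only [add_sub_cancel_left, real_inner_smul_right]

/-- **The head density on the chart**: `f(X(r,θ)) = −(t′(cos θ) sin θ / r) u_θ − r⁻² L(θ)`, for any meridian half-plane (unit
`n' ⊥ e`) and the reference profile `L` taken in the half-plane of `n`. [folklore] -/
theorem zonalHead_chart
    (hf : f = fun z : E3 => ⟪u z, gradient (fun w : E3 => t (⟪w - x₀, e⟫ / ‖w - x₀‖)) z⟫
      - Δ (fun w : E3 => t (⟪w - x₀, e⟫ / ‖w - x₀‖)) z)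
    (he : ‖e‖ = 1) (hn : ‖n‖ = 1) (hen : ⟪e, n⟫ = 0) {n' : E3} (hn' : ‖n'‖ = 1) (hen' : ⟪e, n'⟫ = 0) {r : ℝ} (hr : 0 < r)
    (θ : ℝ) (htd : DifferentiableAt ℝ t (Real.cos θ)) :
    f (x₀ + r • (Real.cos θ • e + Real.sin θ • n')) =
      -(deriv t (Real.cos θ) * Real.sin θ / r) * ⟪u (x₀ + r • (Real.cos θ • e + Real.sin θ • n')), Real.cos θ • n' - Real.sin θ • e⟫
        - (r ^ 2)⁻¹ * Δ (fun w : E3 => t (⟪w - x₀, e⟫ / ‖w - x₀‖)) (x₀ + (Real.cos θ • e + Real.sin θ • n)) := by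
  rw [hf]
  simp only
  rw [gradient_zonal_chart t he hn' hen' hr θ htd, laplacian_zonal_chart t he hn' hen' hn hen hr θ, real_inner_smul_right,
    neg_mul]

/-! ### Rotation invariance of `u_r` and `u_θ` from the law components (i), (ii) -/

/-- **`u_r` is zonal**: under (i), `ρ ↦ u_r(S(ρ,θ,φ))` and `ρ ↦ u_r(X(ρ,θ))` agree near every `r > R`. [folklore] -/
theorem zonal_radial_invariance (hu : ContDiff ℝ 1 u) (hm : m = fun z : E3 => ⟪u z, z - x₀⟫) (he : ‖e‖ = 1) (hn : ‖n‖ = 1)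
    (hen : ⟪e, n⟫ = 0) (hR : 0 ≤ R) (hKm : ∀ x : E3, R < ‖x - x₀‖ → ⟪gradient m x, cross e (x - x₀)⟫ = 0) {r : ℝ}
    (hr : R < r) (θ φ : ℝ) :
    (fun ρ : ℝ => ⟪u (x₀ + ρ • (Real.cos θ • e + Real.sin θ • (Real.cos φ • n + Real.sin φ • cross e n))),
        Real.cos θ • e + Real.sin θ • (Real.cos φ • n + Real.sin φ • cross e n)⟫) =ᶠ[𝓝 r]
      fun ρ : ℝ => ⟪u (x₀ + ρ • (Real.cos θ • e + Real.sin θ • n)), Real.cos θ • e + Real.sin θ • n⟫ := by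
  have hmd : ∀ x : E3, R < ‖x - x₀‖ → DifferentiableAt ℝ m x := fun x _ => by
    rw [hm]; exact ((hu.differentiable one_ne_zero x).inner ℝ ((differentiableAt_id).sub (differentiableAt_const _)))
  filter_upwards [Ioi_mem_nhds hr] with ρ hρ
  have hρ0 : ρ ≠ 0 := ((hR.trans_lt hρ).ne')
  have h := comp_chart_azimuth_eq (F := m) he hn hen hR hmd hKm hρ θ φ
  rw [zonalMomentum_chart hm, zonalMomentum_chart hm] at h
  exact mul_left_cancel₀ hρ0 h

/-- **`u_θ` is zonal**: under (ii), `ϑ ↦ u_θ(S(r,ϑ,φ))` and `ϑ ↦ u_θ(X(r,ϑ))` agree near every `θ ∈ (0,π)` (`r > R`), the polar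
components being read off the head density `f(X) = −(h sin θ/r) u_θ − L/r²` (`h > 0`). [folklore] -/
theorem zonal_polar_invariance (hu : ContDiff ℝ 1 u) (ht : ContDiff ℝ 3 t) (hh : ∀ θ : ℝ, 0 < deriv t (Real.cos θ))
    (hf : f = fun z : E3 => ⟪u z, gradient (fun w : E3 => t (⟪w - x₀, e⟫ / ‖w - x₀‖)) z⟫
      - Δ (fun w : E3 => t (⟪w - x₀, e⟫ / ‖w - x₀‖)) z)
    (he : ‖e‖ = 1) (hn : ‖n‖ = 1) (hen : ⟪e, n⟫ = 0) (hR : 0 ≤ R)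
    (hKf : ∀ x : E3, R < ‖x - x₀‖ → ⟪gradient f x, cross e (x - x₀)⟫ = 0) {r θ : ℝ} (hr : R < r)
    (hθ : θ ∈ Ioo 0 Real.pi) (φ : ℝ) :
    (fun ϑ : ℝ => ⟪u (x₀ + r • (Real.cos ϑ • e + Real.sin ϑ • (Real.cos φ • n + Real.sin φ • cross e n))),
        Real.cos ϑ • (Real.cos φ • n + Real.sin φ • cross e n) - Real.sin ϑ • e⟫) =ᶠ[𝓝 θ]
      fun ϑ : ℝ => ⟪u (x₀ + r • (Real.cos ϑ • e + Real.sin ϑ • n)), Real.cos ϑ • n - Real.sin ϑ • e⟫ := by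
  have hr0 : 0 < r := hR.trans_lt hr
  have hfd : ∀ x : E3, R < ‖x - x₀‖ → DifferentiableAt ℝ f x := fun x hx => by
    have hx0 : x ≠ x₀ := by
      intro h; rw [h, sub_self, norm_zero] at hx; exact absurd hx (not_lt.2 hR)
    rw [hf]; exact differentiableAt_zonalHead hu ht hx0
  have htd : ∀ ϑ : ℝ, DifferentiableAt ℝ t (Real.cos ϑ) := fun ϑ => ht.differentiable (by norm_num) _
  filter_upwards [Ioo_mem_nhds hθ.1 hθ.2] with ϑ hϑ
  have h := comp_chart_azimuth_eq (F := f) he hn hen hR hfd hKf hr ϑ φ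
  rw [zonalHead_chart hf he hn hen (norm_azimuthVec he hn hen φ) (inner_axis_azimuthVec hen φ) hr0 ϑ (htd ϑ),
    zonalHead_chart hf he hn hen hn hen hr0 ϑ (htd ϑ)] at h
  have hc : -(deriv t (Real.cos ϑ) * Real.sin ϑ / r) ≠ 0 :=
    neg_ne_zero.2 (div_ne_zero (mul_ne_zero (hh ϑ).ne' (Real.sin_pos_of_pos_of_lt_pi hϑ.1 hϑ.2).ne') hr0.ne')
  exact mul_left_cancel₀ hc (sub_left_injective h)

/-! ### The law component (iii) on the chart -/

/-- **(iii) on the chart**: `r ∂_θ(f∘X) = t′(cos θ) sin θ ∂_r(m∘X)` at `X = x₀ + r e_r(θ)`, `θ ∈ (0,π)`, written with the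
gradients (`∂_θ(f∘X) = ⟪∇f(X), r e_θ⟫`, `∂_r(m∘X) = ⟪∇m(X), e_r⟫`). [folklore] -/
theorem law_iii_chart (he : ‖e‖ = 1) (hn : ‖n‖ = 1) (hen : ⟪e, n⟫ = 0) {r θ : ℝ} (hr : 0 < r) (hθ : θ ∈ Ioo 0 Real.pi)
    {gf gm : E3}
    (hiii : ‖x₀ + r • (Real.cos θ • e + Real.sin θ • n) - x₀‖ ^ 3 *
        ⟪gf, gradient (fun w : E3 => ⟪w - x₀, e⟫ / ‖w - x₀‖) (x₀ + r • (Real.cos θ • e + Real.sin θ • n))⟫ =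
      -deriv t (⟪x₀ + r • (Real.cos θ • e + Real.sin θ • n) - x₀, e⟫ / ‖x₀ + r • (Real.cos θ • e + Real.sin θ • n) - x₀‖) *
        ((1 - (⟪x₀ + r • (Real.cos θ • e + Real.sin θ • n) - x₀, e⟫ / ‖x₀ + r • (Real.cos θ • e + Real.sin θ • n) - x₀‖) ^ 2) /
          ‖x₀ + r • (Real.cos θ • e + Real.sin θ • n) - x₀‖) *
        ⟪gm, x₀ + r • (Real.cos θ • e + Real.sin θ • n) - x₀⟫) :
    r * ⟪gf, r • (Real.cos θ • n - Real.sin θ • e)⟫ = deriv t (Real.cos θ) * Real.sin θ * ⟪gm, Real.cos θ • e + Real.sin θ • n⟫ := by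
  have hs : Real.sin θ ≠ 0 := (Real.sin_pos_of_pos_of_lt_pi hθ.1 hθ.2).ne'
  rw [axisCos_chart he hn hen hr, gradient_axisCos_chart he hn hen hr, norm_chart_sub (norm_polarVec he hn hen θ) hr.le,
    add_sub_cancel_left, real_inner_smul_right, real_inner_smul_right] at hiii
  rw [real_inner_smul_right]
  have h1 : (1 : ℝ) - Real.cos θ ^ 2 = Real.sin θ ^ 2 := by nlinarith [Real.cos_sq_add_sin_sq θ]
  rw [h1] at hiii
  have hr0 : r ≠ 0 := hr.ne'
  have h2 : r ^ 3 * (-(Real.sin θ / r) * ⟪gf, Real.cos θ • n - Real.sin θ • e⟫) =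
      -(r ^ 2 * Real.sin θ * ⟪gf, Real.cos θ • n - Real.sin θ • e⟫) := by
    field_simp
  have h3 : -deriv t (Real.cos θ) * (Real.sin θ ^ 2 / r) * (r * ⟪gm, Real.cos θ • e + Real.sin θ • n⟫) =
      -(deriv t (Real.cos θ) * Real.sin θ ^ 2 * ⟪gm, Real.cos θ • e + Real.sin θ • n⟫) := by
    field_simp
  rw [h2, h3, neg_inj] at hiii
  apply mul_left_cancel₀ hs
  linear_combination hiii

/-! ### The meridian identity (†) -/

/-- `t′ ∈ C²` for `t ∈ C³`. [folklore] -/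
theorem contDiff_two_deriv_of_contDiff_three (ht : ContDiff ℝ 3 t) : ContDiff ℝ 2 (deriv t) := by
  have h := ht
  rw [show (3 : WithTop ℕ∞) = 2 + 1 by norm_num] at h
  exact (contDiff_succ_iff_deriv.1 h).2.2

/-- **The `θ`-identity** (`∂_θ W = −L′ − h sin θ · r ∂_r(r u_r)` in the notation of the no-go): at `X = x₀ + r e_r(θ)`,
`(r, θ) ∈ (R,∞) × (0,π)`,
`r((h′ sin θ + h cos θ) u_θ + h sin θ (r⟪Du e_θ, e_θ⟫ − u_r)) + L′(θ) + r h sin θ (u_r + r⟪Du e_r, e_r⟫) = 0`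
— the `θ`-derivative of `f(X) = −(h sin θ/r) u_θ − L/r²` computed two ways ((iii) and the chain rule). [folklore] -/
theorem zonal_theta_identity (hu : ContDiff ℝ 1 u) (ht : ContDiff ℝ 3 t)
    (hf : f = fun z : E3 => ⟪u z, gradient (fun w : E3 => t (⟪w - x₀, e⟫ / ‖w - x₀‖)) z⟫
      - Δ (fun w : E3 => t (⟪w - x₀, e⟫ / ‖w - x₀‖)) z)
    (hm : m = fun z : E3 => ⟪u z, z - x₀⟫) (he : ‖e‖ = 1) (hn : ‖n‖ = 1) (hen : ⟪e, n⟫ = 0) (hR : 0 ≤ R)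
    (hiii : ∀ x : E3, R < ‖x - x₀‖ →
      ‖x - x₀‖ ^ 3 * ⟪gradient f x, gradient (fun w : E3 => ⟪w - x₀, e⟫ / ‖w - x₀‖) x⟫ =
        -deriv t (⟪x - x₀, e⟫ / ‖x - x₀‖) * ((1 - (⟪x - x₀, e⟫ / ‖x - x₀‖) ^ 2) / ‖x - x₀‖) * ⟪gradient m x, x - x₀⟫)
    {r θ : ℝ} (hr : R < r) (hθ : θ ∈ Ioo 0 Real.pi) :
    r * ((deriv (fun ϑ : ℝ => deriv t (Real.cos ϑ)) θ * Real.sin θ + deriv t (Real.cos θ) * Real.cos θ) *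
            ⟪u (x₀ + r • (Real.cos θ • e + Real.sin θ • n)), Real.cos θ • n - Real.sin θ • e⟫
          + deriv t (Real.cos θ) * Real.sin θ *
            (r * ⟪fderiv ℝ u (x₀ + r • (Real.cos θ • e + Real.sin θ • n)) (Real.cos θ • n - Real.sin θ • e),
                  Real.cos θ • n - Real.sin θ • e⟫
              - ⟪u (x₀ + r • (Real.cos θ • e + Real.sin θ • n)), Real.cos θ • e + Real.sin θ • n⟫))
        + deriv (fun ϑ : ℝ => Δ (fun w : E3 => t (⟪w - x₀, e⟫ / ‖w - x₀‖)) (x₀ + (Real.cos ϑ • e + Real.sin ϑ • n))) θ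
        + r * deriv t (Real.cos θ) * Real.sin θ *
          (⟪u (x₀ + r • (Real.cos θ • e + Real.sin θ • n)), Real.cos θ • e + Real.sin θ • n⟫
            + r * ⟪fderiv ℝ u (x₀ + r • (Real.cos θ • e + Real.sin θ • n)) (Real.cos θ • e + Real.sin θ • n),
                  Real.cos θ • e + Real.sin θ • n⟫) = 0 := by
  have hr0 : 0 < r := hR.trans_lt hr
  have hud : ∀ x, DifferentiableAt ℝ u x := fun x => hu.differentiable one_ne_zero x
  have hev := norm_polarVec he hn hen θ
  set X : E3 := x₀ + r • (Real.cos θ • e + Real.sin θ • n) with hX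
  have hXs : R < ‖X - x₀‖ := by rw [hX, norm_chart_sub hev hr0.le]; exact hr
  have hX0 : X ≠ x₀ := chart_ne hev hr0.ne'
  -- regularity of `t′`, `h`, `L`, `f`, `m`
  have ht' : ContDiff ℝ 2 (deriv t) := contDiff_two_deriv_of_contDiff_three ht
  have hhfun : ContDiff ℝ 2 (fun ϑ : ℝ => deriv t (Real.cos ϑ)) := ht'.comp Real.contDiff_cos
  have hhd : HasDerivAt (fun ϑ : ℝ => deriv t (Real.cos ϑ)) (deriv (fun ϑ : ℝ => deriv t (Real.cos ϑ)) θ) θ :=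
    (hhfun.differentiable (by norm_num) θ).hasDerivAt
  have hLd : HasDerivAt (fun ϑ : ℝ => Δ (fun w : E3 => t (⟪w - x₀, e⟫ / ‖w - x₀‖)) (x₀ + (Real.cos ϑ • e + Real.sin ϑ • n)))
      (deriv (fun ϑ : ℝ => Δ (fun w : E3 => t (⟪w - x₀, e⟫ / ‖w - x₀‖)) (x₀ + (Real.cos ϑ • e + Real.sin ϑ • n))) θ) θ :=
    ((contDiff_laplacian_zonal_circle ht he hn hen).differentiable one_ne_zero θ).hasDerivAt
  have hfd : DifferentiableAt ℝ f X := by rw [hf]; exact differentiableAt_zonalHead hu ht hX0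
  have hmd : DifferentiableAt ℝ m X := by
    rw [hm]; exact ((hud X).inner ℝ ((differentiableAt_id).sub (differentiableAt_const _)))
  have htd : ∀ ϑ : ℝ, DifferentiableAt ℝ t (Real.cos ϑ) := fun ϑ => ht.differentiable (by norm_num) _
  -- abbreviations
  set s := Real.sin θ with hs
  set c := Real.cos θ with hc
  set hv := deriv t c with hhv
  set h' := deriv (fun ϑ : ℝ => deriv t (Real.cos ϑ)) θ with hh'
  set L' := deriv (fun ϑ : ℝ => Δ (fun w : E3 => t (⟪w - x₀, e⟫ / ‖w - x₀‖)) (x₀ + (Real.cos ϑ • e + Real.sin ϑ • n))) θ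
    with hL'
  set A := ⟪u X, c • e + s • n⟫ with hA
  set B := ⟪u X, c • n - s • e⟫ with hB
  set Ar := ⟪fderiv ℝ u X (c • e + s • n), c • e + s • n⟫ with hAr
  set Sθ := ⟪fderiv ℝ u X (c • n - s • e), c • n - s • e⟫ with hSθ
  set Pr := ⟪gradient m X, c • e + s • n⟫ with hPr
  set Qθ := ⟪gradient f X, r • (c • n - s • e)⟫ with hQθ
  set Bθ := r * Sθ - A with hBθ
  -- R1: two derivatives of `ρ ↦ m(X(ρ,θ))`
  have R1 : Pr = A + r * Ar := by
    have d1 : HasDerivAt (fun ρ : ℝ => m (x₀ + ρ • (c • e + s • n))) Pr r :=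
      hasDerivAt_comp_curve hmd (hasDerivAt_chart_radius x₀ _ r)
    have d2 : HasDerivAt (fun ρ : ℝ => ρ * ⟪u (x₀ + ρ • (c • e + s • n)), c • e + s • n⟫) (1 * A + r * Ar) r :=
      (hasDerivAt_id' r).mul (hasDerivAt_radial_component x₀ (c • e + s • n) (hud _))
    have heq : (fun ρ : ℝ => m (x₀ + ρ • (c • e + s • n))) = fun ρ => ρ * ⟪u (x₀ + ρ • (c • e + s • n)), c • e + s • n⟫ :=
      funext fun ρ => zonalMomentum_chart hm _ ρ
    rw [heq] at d1
    have := d1.unique d2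
    rw [this, one_mul]
  -- R5: two derivatives of `ϑ ↦ f(X(r,ϑ))`
  have R5 : r ^ 2 * Qθ = -r * (h' * s + hv * c) * B - r * hv * s * Bθ - L' := by
    have d1 : HasDerivAt (fun ϑ : ℝ => f (x₀ + r • (Real.cos ϑ • e + Real.sin ϑ • n))) Qθ θ :=
      hasDerivAt_comp_curve hfd (hasDerivAt_chart_angle x₀ e n r θ)
    have dB : HasDerivAt (fun ϑ : ℝ => ⟪u (x₀ + r • (Real.cos ϑ • e + Real.sin ϑ • n)), Real.cos ϑ • n - Real.sin ϑ • e⟫)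
        Bθ θ := hasDerivAt_polar_component x₀ e n r (hud _)
    have dcoef : HasDerivAt (fun ϑ : ℝ => deriv t (Real.cos ϑ) * Real.sin ϑ / r) ((h' * s + hv * c) / r) θ := by
      have := (hhd.mul (Real.hasDerivAt_sin θ)).div_const r
      exact this.congr_deriv (by rw [hh', hhv, hs, hc])
    have d2 := (dcoef.neg.mul dB).sub (hLd.const_mul (r ^ 2)⁻¹)
    have heq : (fun ϑ : ℝ => f (x₀ + r • (Real.cos ϑ • e + Real.sin ϑ • n))) = fun ϑ : ℝ =>
        -(deriv t (Real.cos ϑ) * Real.sin ϑ / r) *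
            ⟪u (x₀ + r • (Real.cos ϑ • e + Real.sin ϑ • n)), Real.cos ϑ • n - Real.sin ϑ • e⟫
          - (r ^ 2)⁻¹ * Δ (fun w : E3 => t (⟪w - x₀, e⟫ / ‖w - x₀‖)) (x₀ + (Real.cos ϑ • e + Real.sin ϑ • n)) :=
      funext fun ϑ => zonalHead_chart hf he hn hen hn hen hr0 ϑ (htd ϑ)
    rw [heq] at d1
    rw [d1.unique d2]
    simp only [Pi.neg_apply, hA, hB, hBθ, hSθ, hhv, hs, hc, hX]
    field_simp
    ring
  -- R6: the law component (iii) on the chart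
  have R6 : r * Qθ = hv * s * Pr := law_iii_chart (t := t) he hn hen hr0 hθ (hiii X hXs)
  linear_combination R5 - r * R6 - r * hv * s * R1

/-- ★ **The meridian identity (†)**: `L′(θ) = r sin θ (h(θ) u_r(r,θ) − h′(θ) u_θ(r,θ))` on `(R,∞) × (0,π)`, where
`h(θ) = t′(cos θ)`, `L(θ) = ΔZ(x₀ + e_r(θ))`, `u_r = ⟪u(X), e_r⟫`, `u_θ = ⟪u(X), e_θ⟫`, for a `C¹` divergence-free `u`
satisfying the law components (i), (ii), (iii) on the shell (`zonal_theta_identity`, `div u = 0` in the frame, `∂_φ u_φ = 0`).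
[folklore] -/
theorem zonal_dagger (hu : ContDiff ℝ 1 u) (hdiv : VectorCalculus.IsDivFree u) (ht : ContDiff ℝ 3 t)
    (hh : ∀ θ : ℝ, 0 < deriv t (Real.cos θ))
    (hf : f = fun z : E3 => ⟪u z, gradient (fun w : E3 => t (⟪w - x₀, e⟫ / ‖w - x₀‖)) z⟫
      - Δ (fun w : E3 => t (⟪w - x₀, e⟫ / ‖w - x₀‖)) z)
    (hm : m = fun z : E3 => ⟪u z, z - x₀⟫) (he : ‖e‖ = 1) (hn : ‖n‖ = 1) (hen : ⟪e, n⟫ = 0) (hR : 0 ≤ R)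
    (hKm : ∀ x : E3, R < ‖x - x₀‖ → ⟪gradient m x, cross e (x - x₀)⟫ = 0)
    (hKf : ∀ x : E3, R < ‖x - x₀‖ → ⟪gradient f x, cross e (x - x₀)⟫ = 0)
    (hiii : ∀ x : E3, R < ‖x - x₀‖ →
      ‖x - x₀‖ ^ 3 * ⟪gradient f x, gradient (fun w : E3 => ⟪w - x₀, e⟫ / ‖w - x₀‖) x⟫ =
        -deriv t (⟪x - x₀, e⟫ / ‖x - x₀‖) * ((1 - (⟪x - x₀, e⟫ / ‖x - x₀‖) ^ 2) / ‖x - x₀‖) * ⟪gradient m x, x - x₀⟫)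
    {r θ : ℝ} (hr : R < r) (hθ : θ ∈ Ioo 0 Real.pi) :
    deriv (fun ϑ : ℝ => Δ (fun w : E3 => t (⟪w - x₀, e⟫ / ‖w - x₀‖)) (x₀ + (Real.cos ϑ • e + Real.sin ϑ • n))) θ =
      r * Real.sin θ *
        (deriv t (Real.cos θ) * ⟪u (x₀ + r • (Real.cos θ • e + Real.sin θ • n)), Real.cos θ • e + Real.sin θ • n⟫
          - deriv (fun ϑ : ℝ => deriv t (Real.cos ϑ)) θ *
            ⟪u (x₀ + r • (Real.cos θ • e + Real.sin θ • n)), Real.cos θ • n - Real.sin θ • e⟫) := by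
  have hr0 : 0 < r := hR.trans_lt hr
  have TI := zonal_theta_identity hu ht hf hm he hn hen hR hiii hr hθ
  -- `div u = 0` in the frame and `∂_φ u_φ = 0`
  have R3 := strain_sum_eq_zero hdiv he hn hen θ (x₀ + r • (Real.cos θ • e + Real.sin θ • n))
  have R4 := azimuthal_strain_eq (x₀ := x₀) hu hdiv he hn hen hr0.ne'
    (fun φ => zonal_radial_invariance hu hm he hn hen hR hKm hr θ φ)
    (fun φ => zonal_polar_invariance hu ht hh hf he hn hen hR hKf hr hθ φ)
  rw [inner_snd_eq_components (u _) e n θ] at R4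
  linear_combination TI - r ^ 2 * deriv t (Real.cos θ) * Real.sin θ * R3 + r * deriv t (Real.cos θ) * R4

end Summit.NavierStokesRegularity.NavierStokesRegularity.Theorems.PoloidalLiouville.KinematicShadow

end
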